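import Summits.NavierStokesRegularity.NavierStokesRegularity.Theorems.CircuitTrace.Negative.Structure
import HarnessLib

/-!
# `PerpetualPump.CircuitTrace`, line `tilted-trace-gronwall`, stub S1 (valve budget) — part I:
# the exact per-scale energy identity of a cyclic Tao circuit

Helper file for crux stmt-NavierStokesRegularity-1836 (`PerpetualPump.CircuitTrace`), supporting the lead's stub
`stub_valveBudget`. For every CYCLIC Tao circuit (`IsCyclic`, Tao2016AveragedNS (4.3)) and every scale `n`, the
scale energy `e_n(t) = Σ_i X_{i,n}(t)²` obeys, pointwise in time and with finite sums only,

  `ė_n = -2 lam^{4n/5} e_n + π_{n-1} - π_n`,  `π_b := 2 lam^b Σ coeff(i₁,i₂,i₃,some 2) X_{i₁,b} X_{i₂,b} X_{i₃,b+1}`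

(`valveBudget_scale_identity`): the `none` and `some 0 / some 1` monomials are the degree-0 and degree-1 parts of
the landed cyclic cancellation `trilinear_cancel` (`Theorems/CircuitTrace/Negative/Structure.lean`) at base `n`,
the `some 2` monomials at output `n` are `+π_{n-1}`. Summed over a block of scales the fluxes telescope
(part II). Everything here is adapted from the kernel-checked crux work file
`Cruxes/CircuitTrace/SketchIdeator2G2.lean` (ideator 2, `efficiencyShadow`), restated without local definitions.
-/

noncomputable section

-- the nested summit namespace `…NavierStokesRegularity.NavierStokesRegularity…` is the tree's layout (D-0017)
set_option linter.dupNamespace false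

namespace Summit.NavierStokesRegularity.NavierStokesRegularity.Theorems.PerpetualPumpCircuitTrace

open Finset
open Summit.NavierStokesRegularity.NavierStokesRegularity.Theorems.CircuitTrace.Negative

-- adapted from Cruxes/CircuitTrace/SketchIdeator2G2.lean (sum_fin3_fun, cyc_expand, cyc_deg0, cyc_deg1,
-- sum_rotate, circuitRHS_expand, shadow_key, hasDerivAt_scaleEnergy, efficiencyShadow)

/-- A sum over `Fin 3 → Fin m` is a triple sum over `Fin m`. [folklore] -/
theorem valveBudget_sum_fin3_fun {m : ℕ} (g : Fin m → Fin m → Fin m → ℝ) :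
    ∑ v : Fin 3 → Fin m, g (v 0) (v 1) (v 2) = ∑ i₁ : Fin m, ∑ i₂ : Fin m, ∑ i₃ : Fin m, g i₁ i₂ i₃ := by
  rw [Fintype.sum_equiv
      (⟨fun v => (v 0, v 1, v 2), fun p => ![p.1, p.2.1, p.2.2],
        fun v => by funext j; fin_cases j <;> rfl, fun p => rfl⟩ : (Fin 3 → Fin m) ≃ Fin m × Fin m × Fin m)
      (fun v => g (v 0) (v 1) (v 2)) (fun p => g p.1 p.2.1 p.2.2) (fun v => rfl)]
  rw [Fintype.sum_prod_type]
  refine Finset.sum_congr rfl fun i₁ _ => ?_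
  rw [Fintype.sum_prod_type]

/-- Expansion of the offset sum in `trilinear_cancel` into its four monomials. [folklore] -/
theorem valveBudget_cyc_expand {m : ℕ} (coeff : Fin m → Fin m → Fin m → Option (Fin 3) → ℝ)
    (Y Z : Fin m → ℝ) (v : Fin 3 → Fin m) :
    ∑ μ : Option (Fin 3), coeff (v 0) (v 1) (v 2) μ * ∏ a : Fin 3, (if μ = some a then Z else Y) (v a)
      = coeff (v 0) (v 1) (v 2) none * Y (v 0) * Y (v 1) * Y (v 2)
        + (coeff (v 0) (v 1) (v 2) (some 0) * Z (v 0) * Y (v 1) * Y (v 2)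
          + coeff (v 0) (v 1) (v 2) (some 1) * Y (v 0) * Z (v 1) * Y (v 2)
          + coeff (v 0) (v 1) (v 2) (some 2) * Y (v 0) * Y (v 1) * Z (v 2)) := by
  rw [Fintype.sum_option, Fin.sum_univ_three]
  simp only [Fin.prod_univ_three, Fin.isValue, reduceCtorEq, ite_false, Option.some.injEq]
  have h01 : ((0 : Fin 3) = 1) = False := by decide
  have h02 : ((0 : Fin 3) = 2) = False := by decide
  have h10 : ((1 : Fin 3) = 0) = False := by decide
  have h12 : ((1 : Fin 3) = 2) = False := by decide
  have h20 : ((2 : Fin 3) = 0) = False := by decide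
  have h21 : ((2 : Fin 3) = 1) = False := by decide
  simp only [h01, h02, h10, h12, h20, h21, ite_true, ite_false]
  ring

/-- Degree-0 consequence of cyclic cancellation: the `none` (amplifier/rotor) monomials conserve the energy of
each scale, `Σ coeff(i₁,i₂,i₃,none) Y_{i₁} Y_{i₂} Y_{i₃} = 0`. [folklore] -/
theorem valveBudget_cyc_deg0 {m : ℕ} {coeff : Fin m → Fin m → Fin m → Option (Fin 3) → ℝ}
    (hcyc : IsCyclic coeff) (Y : Fin m → ℝ) :
    ∑ i₁ : Fin m, ∑ i₂ : Fin m, ∑ i₃ : Fin m, coeff i₁ i₂ i₃ none * Y i₁ * Y i₂ * Y i₃ = 0 := by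
  have h := trilinear_cancel hcyc Y 0
  rw [Finset.sum_congr rfl (fun v _ => valveBudget_cyc_expand coeff Y 0 v)] at h
  simp only [Pi.zero_apply, mul_zero, zero_mul, add_zero] at h
  rw [valveBudget_sum_fin3_fun (fun i₁ i₂ i₃ => coeff i₁ i₂ i₃ none * Y i₁ * Y i₂ * Y i₃)] at h
  exact h

/-- Degree-1 consequence of cyclic cancellation: the three members of the triad `{n,n,n+1}`
(offsets `some 0`, `some 1`, `some 2`) sum to zero. [folklore] -/
theorem valveBudget_cyc_deg1 {m : ℕ} {coeff : Fin m → Fin m → Fin m → Option (Fin 3) → ℝ}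
    (hcyc : IsCyclic coeff) (Y Z : Fin m → ℝ) :
    ∑ i₁ : Fin m, ∑ i₂ : Fin m, ∑ i₃ : Fin m,
      (coeff i₁ i₂ i₃ (some 0) * Z i₁ * Y i₂ * Y i₃
        + coeff i₁ i₂ i₃ (some 1) * Y i₁ * Z i₂ * Y i₃
        + coeff i₁ i₂ i₃ (some 2) * Y i₁ * Y i₂ * Z i₃) = 0 := by
  have h := trilinear_cancel hcyc Y Z
  rw [Finset.sum_congr rfl (fun v _ => valveBudget_cyc_expand coeff Y Z v)] at h
  rw [Finset.sum_add_distrib] at h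
  rw [valveBudget_sum_fin3_fun (fun i₁ i₂ i₃ => coeff i₁ i₂ i₃ none * Y i₁ * Y i₂ * Y i₃),
    valveBudget_cyc_deg0 hcyc Y, zero_add] at h
  rw [valveBudget_sum_fin3_fun (fun i₁ i₂ i₃ => coeff i₁ i₂ i₃ (some 0) * Z i₁ * Y i₂ * Y i₃
        + coeff i₁ i₂ i₃ (some 1) * Y i₁ * Z i₂ * Y i₃
        + coeff i₁ i₂ i₃ (some 2) * Y i₁ * Y i₂ * Z i₃)] at h
  exact h

/-- Rotating a triple sum over `Fin m`. [folklore] -/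
theorem valveBudget_sum_rotate {m : ℕ} (f : Fin m → Fin m → Fin m → ℝ) :
    ∑ i : Fin m, ∑ i₁ : Fin m, ∑ i₂ : Fin m, f i i₁ i₂
      = ∑ i₁ : Fin m, ∑ i₂ : Fin m, ∑ i : Fin m, f i i₁ i₂ := by
  rw [Finset.sum_comm]
  exact Finset.sum_congr rfl (fun i₁ _ => Finset.sum_comm)

/-- Pointwise expansion of the offset sum of `circuitRHS` into its four explicit double sums
(`none`: `X_n X_n`; `some 0`: `X_{n+1} X_n`; `some 1`: `X_n X_{n+1}`; `some 2`: `lam^{n-1} X_{n-1} X_{n-1}`).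
[folklore] -/
theorem valveBudget_circuitRHS_expand (lam : ℝ) {m : ℕ}
    (coeff : Fin m → Fin m → Fin m → Option (Fin 3) → ℝ)
    (X : Fin m → ℤ → ℝ → ℝ) (i : Fin m) (n : ℤ) (t : ℝ) :
    circuitRHS lam coeff X i n t =
      -(lam ^ ((4 / 5 : ℝ) * n)) * X i n t
      + (lam ^ (n : ℝ) * ∑ i₁ : Fin m, ∑ i₂ : Fin m, coeff i₁ i₂ i none * X i₁ n t * X i₂ n t
      + lam ^ (n : ℝ) * ∑ i₁ : Fin m, ∑ i₂ : Fin m, coeff i₁ i₂ i (some 0) * X i₁ (n + 1) t * X i₂ n t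
      + lam ^ (n : ℝ) * ∑ i₁ : Fin m, ∑ i₂ : Fin m, coeff i₁ i₂ i (some 1) * X i₁ n t * X i₂ (n + 1) t
      + lam ^ ((n : ℝ) - 1) * ∑ i₁ : Fin m, ∑ i₂ : Fin m,
          coeff i₁ i₂ i (some 2) * X i₁ (n - 1) t * X i₂ (n - 1) t) := by
  have h01 : ((0 : Fin 3) = 1) = False := by decide
  have h02 : ((0 : Fin 3) = 2) = False := by decide
  have h10 : ((1 : Fin 3) = 0) = False := by decide
  have h12 : ((1 : Fin 3) = 2) = False := by decide
  have h20 : ((2 : Fin 3) = 0) = False := by decide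
  have h21 : ((2 : Fin 3) = 1) = False := by decide
  have hμ : ∀ i₁ i₂ : Fin m,
      (∑ μ : Option (Fin 3), coeff i₁ i₂ i μ * lam ^ ((n : ℝ) - (if μ = some 2 then 1 else 0)) *
        X i₁ (n + ((if μ = some 0 then 1 else 0) - (if μ = some 2 then 1 else 0))) t *
        X i₂ (n + ((if μ = some 1 then 1 else 0) - (if μ = some 2 then 1 else 0))) t)
      = lam ^ (n : ℝ) * (coeff i₁ i₂ i none * X i₁ n t * X i₂ n t)
        + lam ^ (n : ℝ) * (coeff i₁ i₂ i (some 0) * X i₁ (n + 1) t * X i₂ n t)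
        + lam ^ (n : ℝ) * (coeff i₁ i₂ i (some 1) * X i₁ n t * X i₂ (n + 1) t)
        + lam ^ ((n : ℝ) - 1) * (coeff i₁ i₂ i (some 2) * X i₁ (n - 1) t * X i₂ (n - 1) t) := by
    intro i₁ i₂
    rw [Fintype.sum_option, Fin.sum_univ_three]
    simp only [Fin.isValue, reduceCtorEq, ite_false, ite_true, Option.some.injEq, h01, h02, h10, h12,
      h20, h21, sub_zero, add_zero, zero_sub, sub_self, ← sub_eq_add_neg]
    ring
  unfold circuitRHS
  rw [Finset.sum_congr rfl (fun i₁ _ => Finset.sum_congr rfl (fun i₂ _ => hμ i₁ i₂))]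
  simp only [Finset.sum_add_distrib, Finset.mul_sum]

/-- **The key algebraic identity** (scalar shadow): for a cyclic circuit,
`Σ_i 2 X_{i,n} F_{i,n} = -2 lam^{4n/5} e_n + π_{n-1} - π_n` with
`π_b = 2 lam^b Σ coeff(i₁,i₂,i₃,some 2) X_{i₁,b} X_{i₂,b} X_{i₃,b+1}` (written out; `b + 1 = n` for `b = n - 1`).
[folklore] -/
theorem valveBudget_shadow_key {lam : ℝ} {m : ℕ} {coeff : Fin m → Fin m → Fin m → Option (Fin 3) → ℝ}
    (hcyc : IsCyclic coeff) (X : Fin m → ℤ → ℝ → ℝ) (n : ℤ) (t : ℝ) :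
    ∑ i : Fin m, 2 * X i n t * circuitRHS lam coeff X i n t
      = -2 * lam ^ ((4 / 5 : ℝ) * n) * (∑ i : Fin m, (X i n t) ^ 2)
        + 2 * lam ^ ((n : ℝ) - 1) * (∑ i₁ : Fin m, ∑ i₂ : Fin m, ∑ i₃ : Fin m,
            coeff i₁ i₂ i₃ (some 2) * X i₁ (n - 1) t * X i₂ (n - 1) t * X i₃ n t)
        - 2 * lam ^ (n : ℝ) * (∑ i₁ : Fin m, ∑ i₂ : Fin m, ∑ i₃ : Fin m,
            coeff i₁ i₂ i₃ (some 2) * X i₁ n t * X i₂ n t * X i₃ (n + 1) t) := by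
  have h0 := valveBudget_cyc_deg0 hcyc (fun j => X j n t)
  have h1 := valveBudget_cyc_deg1 hcyc (fun j => X j n t) (fun j => X j (n + 1) t)
  beta_reduce at h0 h1
  have h1' : (∑ i₁ : Fin m, ∑ i₂ : Fin m, ∑ i₃ : Fin m,
        coeff i₁ i₂ i₃ (some 0) * X i₁ (n + 1) t * X i₂ n t * X i₃ n t)
      + (∑ i₁ : Fin m, ∑ i₂ : Fin m, ∑ i₃ : Fin m,
        coeff i₁ i₂ i₃ (some 1) * X i₁ n t * X i₂ (n + 1) t * X i₃ n t)
      + (∑ i₁ : Fin m, ∑ i₂ : Fin m, ∑ i₃ : Fin m,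
        coeff i₁ i₂ i₃ (some 2) * X i₁ n t * X i₂ n t * X i₃ (n + 1) t) = 0 := by
    simpa only [Finset.sum_add_distrib] using h1
  have hU0 : ∑ i : Fin m, X i n t * (∑ i₁ : Fin m, ∑ i₂ : Fin m, coeff i₁ i₂ i none * X i₁ n t * X i₂ n t)
      = ∑ i₁ : Fin m, ∑ i₂ : Fin m, ∑ i₃ : Fin m, coeff i₁ i₂ i₃ none * X i₁ n t * X i₂ n t * X i₃ n t := by
    simp only [Finset.mul_sum]
    rw [valveBudget_sum_rotate]
    refine Finset.sum_congr rfl fun i₁ _ => Finset.sum_congr rfl fun i₂ _ =>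
      Finset.sum_congr rfl fun i₃ _ => ?_
    ring
  have hU1 : ∑ i : Fin m, X i n t *
        (∑ i₁ : Fin m, ∑ i₂ : Fin m, coeff i₁ i₂ i (some 0) * X i₁ (n + 1) t * X i₂ n t)
      = ∑ i₁ : Fin m, ∑ i₂ : Fin m, ∑ i₃ : Fin m,
          coeff i₁ i₂ i₃ (some 0) * X i₁ (n + 1) t * X i₂ n t * X i₃ n t := by
    simp only [Finset.mul_sum]
    rw [valveBudget_sum_rotate]
    refine Finset.sum_congr rfl fun i₁ _ => Finset.sum_congr rfl fun i₂ _ =>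
      Finset.sum_congr rfl fun i₃ _ => ?_
    ring
  have hU2 : ∑ i : Fin m, X i n t *
        (∑ i₁ : Fin m, ∑ i₂ : Fin m, coeff i₁ i₂ i (some 1) * X i₁ n t * X i₂ (n + 1) t)
      = ∑ i₁ : Fin m, ∑ i₂ : Fin m, ∑ i₃ : Fin m,
          coeff i₁ i₂ i₃ (some 1) * X i₁ n t * X i₂ (n + 1) t * X i₃ n t := by
    simp only [Finset.mul_sum]
    rw [valveBudget_sum_rotate]
    refine Finset.sum_congr rfl fun i₁ _ => Finset.sum_congr rfl fun i₂ _ =>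
      Finset.sum_congr rfl fun i₃ _ => ?_
    ring
  have hU3 : ∑ i : Fin m, X i n t *
        (∑ i₁ : Fin m, ∑ i₂ : Fin m, coeff i₁ i₂ i (some 2) * X i₁ (n - 1) t * X i₂ (n - 1) t)
      = ∑ i₁ : Fin m, ∑ i₂ : Fin m, ∑ i₃ : Fin m,
          coeff i₁ i₂ i₃ (some 2) * X i₁ (n - 1) t * X i₂ (n - 1) t * X i₃ n t := by
    simp only [Finset.mul_sum]
    rw [valveBudget_sum_rotate]
    refine Finset.sum_congr rfl fun i₁ _ => Finset.sum_congr rfl fun i₂ _ =>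
      Finset.sum_congr rfl fun i₃ _ => ?_
    ring
  have hL : ∑ i : Fin m, 2 * X i n t * circuitRHS lam coeff X i n t
      = (-2 * lam ^ ((4 / 5 : ℝ) * n)) * (∑ i : Fin m, (X i n t) ^ 2)
        + (2 * lam ^ (n : ℝ)) * (∑ i : Fin m, X i n t *
            (∑ i₁ : Fin m, ∑ i₂ : Fin m, coeff i₁ i₂ i none * X i₁ n t * X i₂ n t))
        + (2 * lam ^ (n : ℝ)) * (∑ i : Fin m, X i n t *
            (∑ i₁ : Fin m, ∑ i₂ : Fin m, coeff i₁ i₂ i (some 0) * X i₁ (n + 1) t * X i₂ n t))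
        + (2 * lam ^ (n : ℝ)) * (∑ i : Fin m, X i n t *
            (∑ i₁ : Fin m, ∑ i₂ : Fin m, coeff i₁ i₂ i (some 1) * X i₁ n t * X i₂ (n + 1) t))
        + (2 * lam ^ ((n : ℝ) - 1)) * (∑ i : Fin m, X i n t *
            (∑ i₁ : Fin m, ∑ i₂ : Fin m, coeff i₁ i₂ i (some 2) * X i₁ (n - 1) t * X i₂ (n - 1) t)) := by
    rw [Finset.mul_sum, Finset.mul_sum, Finset.mul_sum, Finset.mul_sum, Finset.mul_sum,
      ← Finset.sum_add_distrib, ← Finset.sum_add_distrib, ← Finset.sum_add_distrib,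
      ← Finset.sum_add_distrib]
    refine Finset.sum_congr rfl fun i _ => ?_
    rw [valveBudget_circuitRHS_expand]
    ring
  rw [hL, hU0, hU1, hU2, hU3, h0]
  linear_combination (2 * lam ^ (n : ℝ)) * h1'

/-- The scale energy `e_n(s) = Σ_i X_{i,n}(s)²` is differentiable wherever the modes of scale `n` solve the
circuit, with derivative `Σ_i 2 X_{i,n} F_{i,n}`. [folklore] -/
theorem valveBudget_hasDerivAt_scaleEnergy {lam : ℝ} {m : ℕ}
    (coeff : Fin m → Fin m → Fin m → Option (Fin 3) → ℝ) (X : Fin m → ℤ → ℝ → ℝ) (n : ℤ) (t : ℝ)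
    (hX : ∀ i : Fin m, HasDerivAt (X i n) (circuitRHS lam coeff X i n t) t) :
    HasDerivAt (fun s => ∑ i : Fin m, (X i n s) ^ 2)
      (∑ i : Fin m, 2 * X i n t * circuitRHS lam coeff X i n t) t := by
  have h2 : ∀ i ∈ (Finset.univ : Finset (Fin m)),
      HasDerivAt (fun s => (X i n s) ^ 2) (2 * X i n t * circuitRHS lam coeff X i n t) t := by
    intro i _
    have := (hX i).pow 2
    refine this.congr_deriv ?_
    norm_num
  have hs := HasDerivAt.sum h2
  have key : (fun s => ∑ i : Fin m, (X i n s) ^ 2) = ∑ i : Fin m, fun s => (X i n s) ^ 2 := by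
    funext s
    simp [Finset.sum_apply]
  rw [key]
  exact hs

/-- **The exact per-scale energy identity of a cyclic Tao circuit** (`efficiency shadow`):
`ė_n = -2 lam^{4n/5} e_n + π_{n-1} - π_n`, `π_b = 2 lam^b Σ coeff(i₁,i₂,i₃,some 2) X_{i₁,b} X_{i₂,b} X_{i₃,b+1}`,
pointwise at any time `t` at which the modes of scale `n` solve the circuit. Only cyclic cancellation is used
(no symmetry, no summability). Registered sub-goal `valveBudget_scale_identity` of stub `stub_valveBudget`.
[folklore] -/
theorem valveBudget_scale_identity :
    ∀ (lam : ℝ) (m : ℕ) (coeff : Fin m → Fin m → Fin m → Option (Fin 3) → ℝ), IsCyclic coeff →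
    ∀ (X : Fin m → ℤ → ℝ → ℝ) (n : ℤ) (t : ℝ),
    (∀ i : Fin m, HasDerivAt (X i n) (circuitRHS lam coeff X i n t) t) →
    HasDerivAt (fun s => ∑ i : Fin m, (X i n s) ^ 2)
      (-2 * lam ^ ((4 / 5 : ℝ) * n) * (∑ i : Fin m, (X i n t) ^ 2)
        + 2 * lam ^ ((n : ℝ) - 1) * (∑ i₁ : Fin m, ∑ i₂ : Fin m, ∑ i₃ : Fin m,
            coeff i₁ i₂ i₃ (some 2) * X i₁ (n - 1) t * X i₂ (n - 1) t * X i₃ n t)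
        - 2 * lam ^ (n : ℝ) * (∑ i₁ : Fin m, ∑ i₂ : Fin m, ∑ i₃ : Fin m,
            coeff i₁ i₂ i₃ (some 2) * X i₁ n t * X i₂ n t * X i₃ (n + 1) t)) t :=
  fun _lam _m coeff hcyc X n t hX =>
    (valveBudget_hasDerivAt_scaleEnergy coeff X n t hX).congr_deriv (valveBudget_shadow_key hcyc X n t)

end Summit.NavierStokesRegularity.NavierStokesRegularity.Theorems.PerpetualPumpCircuitTrace

end
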